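import Summits.BirchSwinnertonDyer.Rank1Residual.F1Sign2.BranchCongruenceModTwoAtTwo
import Summits.BirchSwinnertonDyer.BirchSwinnertonDyer.Theorems.ByReductionTypeAtTwoMultTowerClass76070a
import Literature.NumberTheory.EllipticCurves.LFunctionPrimeCoeffMultiplicative
import HarnessLib

/-!
# Theorems/AnalyticMuZeroMultAtTwo/Negative — `AnalyticMuZeroMultAtTwo` AS TYPED (p543248 :166) is refuted by modularity

REFUTATION OF RECORD (cell `bsd-f1-sign2`, seat `-ref1` g2 = statement-audit refuter; certificate found by the
planner-of-record `-imc` g1, HOME `MEMO-imc-data/F1Sign2ProofsC2.lean` §D, INBOX 2026-08-27T16:08:15Z; class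
**misstated**, repaired statement = `AnalyticMuZeroMultAtTwoR` of `F1Sign2/MultiplicativeAtTwoRepaired.lean`
(T-imc-4a), which types the allowable root as `α := ((W.LFunction 2 : ℤ) : ℚ_[2]) = a₂(E) = ±1`).

WHY IT IS FALSE AS TYPED. `AnalyticMuZeroMultAtTwo` feeds the one-term Mazur–Tate–Teitelbaum branch
`padicLFunctionPlusBranchMult f α 0` the root `α := (W.frobeniusTrace 2 : ℚ_[2])`. In the tree's currency
`W.frobeniusTrace p = p + 1 − #Ẽ_ns(𝔽_p)` equals `a_p(E) + 1 ∈ {0, 2}` at a MULTIPLICATIVE prime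
(`WeierstrassCurve.LFunction_apply_prime_eq_frobeniusTrace_sub_one_of_hasMultiplicativeReductionAtPrime`), not the
allowable root `a_p(E) = ±1`. At a NON-SPLIT multiplicative `2` this gives `α = 0`; the one-term measure
`μ⁺_{f,0}` vanishes at every positive level, so `L₂⁺(f, 0, ω⁰, T) = 0`, and `G := 0 ∈ Λ₂` satisfies `ι G = L`
with `red G = 0` — contradicting the statement's conclusion `red G ≠ 0` for EVERY modular curve with non-split
multiplicative reduction at `2` and no rational `2`-torsion. The kernel-decided X5 class instance `76070a1`
(`Theorems/ByReductionTypeAtTwoMultTowerClass76070a.lean`: elliptic, globally minimal, multiplicative NON-SPLIT at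
`2`, `E[2]` irreducible) is such a curve; its newform is supplied by the tree's standing modularity hypothesis
`exists_isNewformOf` (Breuil–Conrad–Diamond–Taylor), which the tree does not construct — hence this file is a
NEGATIVE LEMMA MODULO `exists_isNewformOf`:

* `analyticMuZeroMultAtTwo_false_of_exists_isNewformOf : exists_isNewformOf → ¬ AnalyticMuZeroMultAtTwo`.

Also recorded: the statement forbids a newform for `76070a1` outright
(`not_isNewformOf_76070a1_of_analyticMuZeroMultAtTwo`), and the general non-split certificate
(`analyticMuZeroMultAtTwo_forbids_nonsplit`, verbatim from -imc's §D with this file's namespace).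
No statement of the tree is re-declared; no positive conclusion about any F1Sign2 conjecture is asserted.
References: [MazurTateTeitelbaum1986Invent] §I.10 (10.1) with `ε(p) = 0`, §I.13; [SilvermanAEC2009] Ex. 3.5,
Ex. 8.19(a), §C.16; [CremonaAlgorithms1997] Table 1 (76070a1); [DiamondShurman2005] Thm. 8.8.3.
-/

set_option autoImplicit false
-- the Theorems namespace of this sub repeats the summit name by design (D-0017 nested layout: Summit.<S>.<Sub>)
set_option linter.dupNamespace false

noncomputable section

open scoped Classical MatrixGroups ModularForm

open CongruenceSubgroup WeierstrassCurve Literature.NumberTheory.EllipticCurves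
  Literature.NumberTheory.EllipticCurves.ModularForms Literature.NumberTheory.EllipticCurves.Greenberg1999
  Literature.NumberTheory.EllipticCurves.Rank1Residual
  Summit.BirchSwinnertonDyer.Rank1Residual.X1.MuLambda Summit.BirchSwinnertonDyer.Rank1Residual.X5
  Summit.BirchSwinnertonDyer.BirchSwinnertonDyer.Theorems.MultTowerClass

namespace Summit.BirchSwinnertonDyer.BirchSwinnertonDyer.Theorems.AnalyticMuZeroMultAtTwoNegative
open Summit.BirchSwinnertonDyer.Rank1Residual.F1Sign2

open Filter Topology

/-! ## §1 The `α = 0` one-term branch vanishes (certificate of -imc g1, §D) -/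

/-- With `α = 0` the one-term plus measure vanishes at every positive level (`α⁻¹ ^ m = 0`).
[cite: MazurTateTeitelbaum1986Invent, §I.10 (10.1) with ε(p) = 0] -/
theorem msdPlusMeasureMult_zero_alpha {N : ℕ} (f : CuspForm (Gamma0 N) 2) {m : ℕ} (hm : m ≠ 0)
    (a : ZMod (2 ^ m)) : msdPlusMeasureMult f (0 : ℚ_[2]) m a = 0 := by
  simp [msdPlusMeasureMult, hm]

/-- With `α = 0` every Riemann sum of the one-term plus branch vanishes, so `L₂⁺(f, 0, ω^i, T) = 0`.
[cite: MazurTateTeitelbaum1986Invent, §I.13] -/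
theorem padicLFunctionPlusBranchMult_zero_alpha {N : ℕ} (f : CuspForm (Gamma0 N) 2) (i : ℕ) :
    padicLFunctionPlusBranchMult f (0 : ℚ_[2]) i = 0 := by
  ext k
  rw [coeff_padicLFunctionPlusBranchMult, map_zero]
  have h : padicLPlusBranchMultRiemannSum f (0 : ℚ_[2]) i k = fun _ ↦ 0 := by
    funext n
    unfold padicLPlusBranchMultRiemannSum
    refine finsum_eq_zero_of_forall_eq_zero fun ζ ↦ Finset.sum_eq_zero fun s _ ↦ ?_
    rw [msdPlusMeasureMult_zero_alpha f (by show n + 2 ≠ 0; omega), mul_zero, zero_mul]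
  unfold padicLPlusBranchMultCoeff
  rw [h]
  exact tendsto_const_nhds.limUnder_eq

/-! ## §2 The tree's `frobeniusTrace` at a non-split multiplicative `2` is `0` -/

/-- In the tree's currency `W.frobeniusTrace 2 = 0` at a NON-SPLIT multiplicative `2` (`a₂(E) = −1`,
`frobeniusTrace = a₂(E) + 1`). [cite: SilvermanAEC2009, Exercise 8.19(a) (p. 230) and Exercise 3.5 (PDF p. 97)] -/
theorem frobeniusTrace_two_eq_zero_of_nonsplit (W : WeierstrassCurve ℚ) [W.IsElliptic]
    [W.IsGloballyMinimal] (hm : W.HasMultiplicativeReductionAtPrime 2)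
    (hns : ¬ W.HasSplitMultiplicativeReductionAtPrime 2) : W.frobeniusTrace 2 = 0 := by
  have h1 := W.LFunction_apply_prime_eq_frobeniusTrace_sub_one_of_hasMultiplicativeReductionAtPrime 2 hm
  have h2 := W.LFunction_apply_prime_of_hasMultiplicativeReductionAtPrime_of_not_split 2 hm hns
  omega

/-! ## §3 No rational `2`-torsion from `E[2]` irreducible -/

/-- `Irr W 2` (no rational point of order `2`) discharges the binder `∀ x, ¬ HasRationalTwoTorsionX W x`
(a rational affine point with `2y + a₁x + a₃ = 0` IS a point of order `2`, Silverman AEC III.2.3).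
[cite: SilvermanAEC2009, III.2.3] -/
theorem not_hasRationalTwoTorsionX_of_irr (W : WeierstrassCurve ℚ) [W.IsElliptic] (hirr : Irr W 2)
    (x : ℚ) : ¬ HasRationalTwoTorsionX W x := fun hx ↦
  (O1.irr_two_iff_not_exists_addOrderOf_eq_two W).mp hirr (Instances.exists_point_addOrderOf_eq_two hx)

/-! ## §4 The refutation -/

/-- **AUDIT CERTIFICATE (-imc g1 §D, re-homed).** `AnalyticMuZeroMultAtTwo` AS TYPED forbids every curve with
NON-SPLIT multiplicative reduction at `2` and no rational `2`-torsion from having a newform: take `G = 0`,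
`ι 0 = 0 = L₂⁺(f, 0, ω⁰)`. [cite: MazurTateTeitelbaum1986Invent, §I.13] -/
theorem analyticMuZeroMultAtTwo_forbids_nonsplit (h : AnalyticMuZeroMultAtTwo) (W : WeierstrassCurve ℚ)
    [W.IsElliptic] [W.IsGloballyMinimal] (hm : W.HasMultiplicativeReductionAtPrime 2)
    (hns : ¬ W.HasSplitMultiplicativeReductionAtPrime 2) (htor : ∀ x : ℚ, ¬ HasRationalTwoTorsionX W x)
    ⦃N : ℕ⦄ [NeZero N] (f : CuspForm (Gamma0 N) 2) (hf : IsNewformOf W f) : False := by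
  have h0 := frobeniusTrace_two_eq_zero_of_nonsplit W hm hns
  refine h W hm htor f hf 0 ?_ (by simp [red])
  rw [map_zero, h0, Int.cast_zero, padicLFunctionPlusBranchMult_zero_alpha]

/-- **The concrete witness.** Under `AnalyticMuZeroMultAtTwo` as typed, the X5 class instance `76070a1`
(`N = 2·5·7607`, non-split multiplicative at `2`, `E[2]` irreducible — all kernel-decided in
`ByReductionTypeAtTwoMultTowerClass76070a.lean`) has NO newform of any level.
[cite: CremonaAlgorithms1997, Table 1] -/
theorem not_isNewformOf_76070a1_of_analyticMuZeroMultAtTwo (h : AnalyticMuZeroMultAtTwo) ⦃N : ℕ⦄ [NeZero N]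
    (f : CuspForm (Gamma0 N) 2) : ¬ IsNewformOf c76070a1 f := fun hf ↦
  analyticMuZeroMultAtTwo_forbids_nonsplit h c76070a1 mult_two_76070a1 nonsplit_two_76070a1
    (not_hasRationalTwoTorsionX_of_irr c76070a1 irr_two_76070a1) f hf

/-- **REFUTATION OF RECORD (negative lemma modulo modularity).** The tree's standing modularity hypothesis
`exists_isNewformOf` (Breuil–Conrad–Diamond–Taylor; conductor `N_E ≥ 1` by the proved
`conductorNorm_pos_holds`) refutes `AnalyticMuZeroMultAtTwo` AS TYPED. Class: misstated (the `frobeniusTrace`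
currency at a bad prime); repaired statement: `AnalyticMuZeroMultAtTwoR` (T-imc-4a), which this witness does not
touch (`α = a₂(E) = −1` there, a unit). [cite: DiamondShurman2005, Thm. 8.8.3] -/
theorem analyticMuZeroMultAtTwo_false_of_exists_isNewformOf (hmod : exists_isNewformOf) :
    ¬ AnalyticMuZeroMultAtTwo := by
  intro h
  haveI : NeZero (c76070a1.conductorNorm ℤ) := ⟨(c76070a1.conductorNorm_pos_holds).ne'⟩
  obtain ⟨f, hf⟩ := hmod c76070a1
  exact not_isNewformOf_76070a1_of_analyticMuZeroMultAtTwo h f hf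

end Summit.BirchSwinnertonDyer.BirchSwinnertonDyer.Theorems.AnalyticMuZeroMultAtTwoNegative

end
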